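import Summits.CriticalPhenomena.PercolationContinuityZ3.Theorems.PercNearOneGluingNoHeavyPcintNawRandWindowCert
import Summits.CriticalPhenomena.PercolationContinuityZ3.Theorems.PercNearOneGluingNoHeavyPcintChordRandBooking
import HarnessLib

/-!
# PCINT lane, kind `chordrand_cw`: window gap sites of a self-avoiding word, off and on the path

Cell `prim-pcint`, seat `prim-pcint-2`; memo `run/shared/lean/prim/pcint/REDUCTIONS.md` §B3r.2, §B3r.6.
Does NOT build on p205010.

For a self-avoiding (not necessarily neighbour-avoiding) word, the genuine window gap sites at time `t` split
into sites OFF the path — full gap sites of time `t + m + 2` (`mem_gapSet_of_offWin`, `card_offWin_le`,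
`card_offWin_lt` for a sound window corner that is not a full corner) — and sites ON the path, which together
with an on-path window corner inject into the `t`-fibre of the on-path events of `…ChordRandBooking`
(`card_onWin_le`).
-/

noncomputable section

namespace Summit.CriticalPhenomena.PercolationContinuityZ3.Theorems.Pcint

open Finset Literature.Probability.Percolation Literature.Probability.LatticeModels

variable {d m : ℕ} (a₀ : Fin d × Bool)

/-! ### Off-path window gap sites of a self-avoiding word -/

/-- A translated window gap site that is off the path is a full gap site (time `t + m + 2`). [folklore] -/
theorem mem_gapSet_of_offWin {k : ℕ} {γ : Fin (m + 1 + k) → Fin d × Bool} {t : ℕ} (ht : t < k) {w' : Site d}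
    (hw' : w' ∈ winGapSet (winAt (m := m + 1) a₀ γ t) (wordAt a₀ γ (t + (m + 1))))
    (hoff : w' + wordPos γ t ∉ pathSites γ) : w' + wordPos γ t ∈ gapSet γ (t + m + 2) := by
  have htm : t + (m + 1) < m + 1 + k := by omega
  obtain ⟨hadj, -, i, hi3, hiw⟩ := mem_winGapSet.1 hw'
  rw [wordPos_wext_winAt a₀ γ htm le_rfl] at hadj
  rw [wordPos_wext_winAt a₀ γ htm (by omega)] at hiw
  have hadj' : (zdGraph d).Adj (wordPos γ (t + m + 2)) (w' + wordPos γ t) := by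
    rw [← Literature.Probability.RandomPlanarGeometry.SAW.Zd.zdGraph_adj_sub_right _ _ (wordPos γ t),
      add_sub_cancel_right, show t + m + 2 = t + (m + 1 + 1) by ring]; exact hadj
  have hiw' : (zdGraph d).Adj (wordPos γ (t + i)) (w' + wordPos γ t) := by
    rw [← Literature.Probability.RandomPlanarGeometry.SAW.Zd.zdGraph_adj_sub_right _ _ (wordPos γ t),
      add_sub_cancel_right]; exact hiw
  exact mem_gapSet.2 ⟨hadj', hoff, t + i, by omega, hiw'⟩

/-- The off-path window gap sites are at most the full gap sites. [folklore] -/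
theorem card_offWin_le {k : ℕ} {γ : Fin (m + 1 + k) → Fin d × Bool} {t : ℕ} (ht : t < k) :
    ((winGapSet (winAt (m := m + 1) a₀ γ t) (wordAt a₀ γ (t + (m + 1)))).filter
        fun w' => w' + wordPos γ t ∉ pathSites γ).card ≤ (gapSet γ (t + m + 2)).card :=
  Finset.card_le_card_of_injOn (fun w' => w' + wordPos γ t)
    (fun w' hw' => by
      obtain ⟨h1, h2⟩ := mem_filter.1 (mem_coe.1 hw')
      exact mem_coe.2 (mem_gapSet_of_offWin a₀ ht h1 h2))
    (fun x _ y _ h => add_right_cancel h)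

/-- A sound window corner whose site is off the path but which is not a full corner adds a full gap site.
[folklore] -/
theorem card_offWin_lt {k : ℕ} {γ : Fin (m + 1 + k) → Fin d × Bool} (hs : IsSAW γ) {t : ℕ} (ht : t < k)
    (hwc : WinCornerTrue (winAt (m := m + 1) a₀ γ t) (wordAt a₀ γ (t + (m + 1))))
    (hcoff : cornerSite γ (t + m) ∉ pathSites γ) (hnc : ¬ IsCorner γ (t + m)) :
    ((winGapSet (winAt (m := m + 1) a₀ γ t) (wordAt a₀ γ (t + (m + 1)))).filter
        fun w' => w' + wordPos γ t ∉ pathSites γ).card < (gapSet γ (t + m + 2)).card := by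
  have htm : t + (m + 1) < m + 1 + k := by omega
  have ha : wordAt a₀ γ (t + (m + 1)) = γ ⟨t + m + 1, by omega⟩ := wordAt_of_lt a₀ γ htm
  have hPm : wordPos (wext (winAt (m := m + 1) a₀ γ t) (wordAt a₀ γ (t + (m + 1)))) m
      = wordPos γ (t + m) - wordPos γ t := wordPos_wext_winAt a₀ γ htm (by omega)
  have hPm1 : wordPos (wext (winAt (m := m + 1) a₀ γ t) (wordAt a₀ γ (t + (m + 1)))) (m + 1)
      = wordPos γ (t + m + 1) - wordPos γ t := by
    rw [wordPos_wext_winAt a₀ γ htm (by omega), show t + (m + 1) = t + m + 1 by ring]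
  obtain ⟨hoff, hnoinc⟩ := hwc
  rw [hPm] at hoff hnoinc
  have hcs : cornerSite γ (t + m) = wordPos γ (t + m) + stepVec (wordAt a₀ γ (t + (m + 1))) := by
    rw [cornerSite, dif_pos (by omega : t + m + 1 < m + 1 + k), ha]
  have hT1 : wordPos γ (t + m + 1) = wordPos γ (t + m) + stepVec (γ ⟨t + m, by omega⟩) :=
    wordPos_succ γ (by omega)
  have hT2 : wordPos γ (t + m + 2) = wordPos γ (t + m + 1) + stepVec (wordAt a₀ γ (t + (m + 1))) := by
    rw [ha]; exact wordPos_succ γ (by omega)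
  have hstep : wordPos γ (t + m + 2) = cornerSite γ (t + m) + stepVec (γ ⟨t + m, by omega⟩) := by
    rw [hT2, hT1, hcs]; abel
  have hadjT : (zdGraph d).Adj (wordPos γ (t + m + 2)) (cornerSite γ (t + m)) := by
    rw [(zdGraph d).adj_comm, zdGraph_adj_iff_stepVec]; exact ⟨_, hstep⟩
  have hne1 : cornerSite γ (t + m) ≠ wordPos γ (t + m + 1) := by
    intro he
    refine hoff (m + 1) (by omega) ?_
    rw [hPm1, ← he, hcs]; abel
  have hold : ∃ i, i + 3 ≤ t + m + 2 ∧ (zdGraph d).Adj (wordPos γ i) (cornerSite γ (t + m)) := by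
    by_contra hno
    push Not at hno
    apply hnc
    refine ⟨by omega, ?_, hcoff, fun i hi => hno i (by have := mem_range.1 hi; omega)⟩
    intro hax
    by_cases hsg : (γ ⟨t + m, by omega⟩).2 = (γ ⟨t + m + 1, by omega⟩).2
    · have heq : γ ⟨t + m, by omega⟩ = γ ⟨t + m + 1, by omega⟩ := Prod.ext hax hsg
      exact hne1 (by rw [hcs, ha, ← heq, ← hT1])
    · have hrev : γ ⟨t + m, by omega⟩ = srev (γ ⟨t + m + 1, by omega⟩) := by
        rw [srev]; refine Prod.ext hax ?_
        cases hb : (γ ⟨t + m, by omega⟩).2 <;> cases hb' : (γ ⟨t + m + 1, by omega⟩).2 <;> simp_all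
      have hTS : wordPos γ (t + m + 2) = wordPos γ (t + m) := by
        rw [hstep, hcs, ha, hrev, stepVec_srev]; abel
      have := hs (t + m + 2) (t + m) (by omega) (by omega) hTS
      omega
  obtain ⟨i, hi3, hic⟩ := hold
  have hcg : cornerSite γ (t + m) ∈ gapSet γ (t + m + 2) := mem_gapSet.2 ⟨hadjT, hcoff, i, hi3, hic⟩
  set Woff := (winGapSet (winAt (m := m + 1) a₀ γ t) (wordAt a₀ γ (t + (m + 1)))).filter
    fun w' => w' + wordPos γ t ∉ pathSites γ with hWoff
  have himg : Woff.image (fun w' => w' + wordPos γ t) ⊆ (gapSet γ (t + m + 2)).erase (cornerSite γ (t + m)) := by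
    intro x hx
    rw [mem_image] at hx
    obtain ⟨w', hw', rfl⟩ := hx
    obtain ⟨hw'1, hw'2⟩ := mem_filter.1 hw'
    refine mem_erase.2 ⟨fun hx => ?_, mem_gapSet_of_offWin a₀ ht hw'1 hw'2⟩
    obtain ⟨-, -, i', hi'3, hi'w⟩ := mem_winGapSet.1 hw'1
    refine hnoinc i' (by omega) ?_
    rw [wordPos_wext_winAt a₀ γ htm (by omega)] at hi'w ⊢
    have hw'c : w' = cornerSite γ (t + m) - wordPos γ t := by rw [← hx, add_sub_cancel_right]
    rw [show wordPos γ (t + m) - wordPos γ t + stepVec (wordAt a₀ γ (t + (m + 1)))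
        = cornerSite γ (t + m) - wordPos γ t by rw [hcs]; abel, ← hw'c]
    exact hi'w
  calc Woff.card = (Woff.image fun w' => w' + wordPos γ t).card :=
        (card_image_of_injective _ (add_left_injective (wordPos γ t))).symm
    _ ≤ ((gapSet γ (t + m + 2)).erase (cornerSite γ (t + m))).card := card_le_card himg
    _ < (gapSet γ (t + m + 2)).card := card_erase_lt_of_mem hcg

/-! ### On-path window charges are on-path events -/

/-- The index of a path site (junk `0` off the path). [folklore] -/
def pathIdx {N : ℕ} (γ : Fin N → Fin d × Bool) (x : Site d) : ℕ :=
  if h : ∃ i, i ≤ N ∧ wordPos γ i = x then Classical.choose h else 0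

/-- Specification of `pathIdx` on path sites. [folklore] -/
theorem pathIdx_spec {N : ℕ} (γ : Fin N → Fin d × Bool) {x : Site d} (hx : x ∈ pathSites γ) :
    pathIdx γ x ≤ N ∧ wordPos γ (pathIdx γ x) = x := by
  obtain ⟨i, hi, hix⟩ := mem_pathSites.1 hx
  have h : ∃ i, i ≤ N ∧ wordPos γ i = x := ⟨i, hi, hix⟩
  rw [pathIdx, dif_pos h]
  exact Classical.choose_spec h

/-- **On-path window charges are on-path events**: the on-path window gap sites at time `t`, plus the window
corner when its site is on the path, inject into the `t`-fibre of `onEvents`. [folklore] -/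
theorem card_onWin_le {k : ℕ} {γ : Fin (m + 1 + k) → Fin d × Bool} {t : ℕ} (ht : t < k)
    (cor : Bool) (hcor : cor = true → WinCornerTrue (winAt (m := m + 1) a₀ γ t) (wordAt a₀ γ (t + (m + 1))) ∧
      cornerSite γ (t + m) ∈ pathSites γ) :
    ((winGapSet (winAt (m := m + 1) a₀ γ t) (wordAt a₀ γ (t + (m + 1)))).filter
        fun w' => w' + wordPos γ t ∈ pathSites γ).card + (if cor then 1 else 0) ≤
      ((onEvents m γ).filter fun th => th.1 = t).card := by
  classical
  have htm : t + (m + 1) < m + 1 + k := by omega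
  have ha : wordAt a₀ γ (t + (m + 1)) = γ ⟨t + m + 1, by omega⟩ := wordAt_of_lt a₀ γ htm
  -- the set of charged absolute sites on the path
  set Won := (winGapSet (winAt (m := m + 1) a₀ γ t) (wordAt a₀ γ (t + (m + 1)))).filter
    fun w' => w' + wordPos γ t ∈ pathSites γ with hWon
  set S : Finset (Site d) := Won.image (fun w' => w' + wordPos γ t) ∪
    (if cor then {cornerSite γ (t + m)} else ∅) with hS
  -- every element of `S` is a path site `x` adjacent to `v_T`, not a window site, with an incidence in `[t, t+m]`
  have hSprop : ∀ x ∈ S, x ∈ pathSites γ ∧ (zdGraph d).Adj x (wordPos γ (t + m + 2)) ∧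
      (∀ j, t ≤ j → j ≤ t + m + 2 → wordPos γ j ≠ x) ∧ ∃ i, t ≤ i ∧ i ≤ t + m ∧ (zdGraph d).Adj (wordPos γ i) x := by
    intro x hx
    rw [hS, mem_union] at hx
    rcases hx with hx | hx
    · rw [mem_image] at hx
      obtain ⟨w', hw', rfl⟩ := hx
      obtain ⟨hw'1, hon⟩ := mem_filter.1 hw'
      obtain ⟨hadj, hoffw, i, hi3, hiw⟩ := mem_winGapSet.1 hw'1
      rw [wordPos_wext_winAt a₀ γ htm le_rfl] at hadj
      rw [wordPos_wext_winAt a₀ γ htm (by omega)] at hiw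
      refine ⟨hon, ?_, fun j hj1 hj2 hjx => ?_, t + i, by omega, by omega, ?_⟩
      · rw [← Literature.Probability.RandomPlanarGeometry.SAW.Zd.zdGraph_adj_sub_right _ _ (wordPos γ t),
          add_sub_cancel_right, show t + m + 2 = t + (m + 1 + 1) by ring]; exact hadj.symm
      · refine hoffw (j - t) (by omega) ?_
        rw [wordPos_wext_winAt a₀ γ htm (by omega), show t + (j - t) = j by omega, hjx, add_sub_cancel_right]
      · rw [← Literature.Probability.RandomPlanarGeometry.SAW.Zd.zdGraph_adj_sub_right _ _ (wordPos γ t),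
          add_sub_cancel_right]; exact hiw
    · cases cor
      · simp at hx
      · rw [if_pos rfl, mem_singleton] at hx
        subst hx
        obtain ⟨⟨hoffc, -⟩, honc⟩ := hcor rfl
        have hPm : wordPos (wext (winAt (m := m + 1) a₀ γ t) (wordAt a₀ γ (t + (m + 1)))) m
            = wordPos γ (t + m) - wordPos γ t := wordPos_wext_winAt a₀ γ htm (by omega)
        rw [hPm] at hoffc
        have hcs : cornerSite γ (t + m) = wordPos γ (t + m) + stepVec (wordAt a₀ γ (t + (m + 1))) := by
          rw [cornerSite, dif_pos (by omega : t + m + 1 < m + 1 + k), ha]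
        have hT1 : wordPos γ (t + m + 1) = wordPos γ (t + m) + stepVec (γ ⟨t + m, by omega⟩) :=
          wordPos_succ γ (by omega)
        have hT2 : wordPos γ (t + m + 2) = wordPos γ (t + m + 1) + stepVec (wordAt a₀ γ (t + (m + 1))) := by
          rw [ha]; exact wordPos_succ γ (by omega)
        have hstep : wordPos γ (t + m + 2) = cornerSite γ (t + m) + stepVec (γ ⟨t + m, by omega⟩) := by
          rw [hT2, hT1, hcs]; abel
        refine ⟨honc, ?_, fun j hj1 hj2 hjx => ?_, t + m, by omega, by omega, ?_⟩
        · rw [zdGraph_adj_iff_stepVec]; exact ⟨_, hstep⟩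
        · refine hoffc (j - t) (by omega) ?_
          rw [wordPos_wext_winAt a₀ γ htm (by omega), show t + (j - t) = j by omega, hjx, hcs]; abel
        · rw [zdGraph_adj_iff_stepVec]; exact ⟨_, hcs⟩
  -- the map `x ↦ (t, pathIdx x)` is injective on `S` and lands in the `t`-fibre of `onEvents`
  have hcardS : S.card = Won.card + (if cor then 1 else 0) := by
    rw [hS, card_union_of_disjoint, card_image_of_injective _ (add_left_injective (wordPos γ t))]
    · cases cor
      · simp
      · rw [if_pos rfl, if_pos rfl, card_singleton]
    · cases cor
      · simp
      · rw [if_pos rfl, disjoint_singleton_right, mem_image]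
        rintro ⟨w', hw', hwc⟩
        obtain ⟨hw'1, -⟩ := mem_filter.1 hw'
        obtain ⟨-, -, i', hi'3, hi'w⟩ := mem_winGapSet.1 hw'1
        obtain ⟨⟨-, hnoinc⟩, -⟩ := hcor rfl
        refine hnoinc i' (by omega) ?_
        -- `w'` is the relative corner site
        have hPm : wordPos (wext (winAt (m := m + 1) a₀ γ t) (wordAt a₀ γ (t + (m + 1)))) m
            = wordPos γ (t + m) - wordPos γ t := wordPos_wext_winAt a₀ γ htm (by omega)
        have hcs : cornerSite γ (t + m) = wordPos γ (t + m) + stepVec (wordAt a₀ γ (t + (m + 1))) := by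
          rw [cornerSite, dif_pos (by omega : t + m + 1 < m + 1 + k), ha]
        rw [hPm, show wordPos γ (t + m) - wordPos γ t + stepVec (wordAt a₀ γ (t + (m + 1))) = w' by
          rw [← add_sub_right_comm, ← hcs, ← hwc, add_sub_cancel_right]]
        exact hi'w
  rw [← hcardS]
  refine Finset.card_le_card_of_injOn (fun x => (t, pathIdx γ x)) (fun x hx => ?_) (fun x hx y hy hxy => ?_)
  · obtain ⟨hxp, hadj, hnotwin, i, hi1, hi2, hiadj⟩ := hSprop x (mem_coe.1 hx)
    obtain ⟨hle, hpos⟩ := pathIdx_spec γ hxp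
    rw [mem_coe, mem_filter, mem_onEvents]
    refine ⟨⟨ht, hle, ?_, by rw [hpos]; exact hadj, i, hi1, hi2, by rw [hpos]; exact hiadj⟩, rfl⟩
    by_contra hh
    push Not at hh
    exact hnotwin (pathIdx γ x) hh.1 hh.2 hpos
  · have hx' := (pathIdx_spec γ (hSprop x (mem_coe.1 hx)).1).2
    have hy' := (pathIdx_spec γ (hSprop y (mem_coe.1 hy)).1).2
    rw [← hx', ← hy', (Prod.mk.inj hxy).2]

end Summit.CriticalPhenomena.PercolationContinuityZ3.Theorems.Pcint
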